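import Mathlib
import Summits.Ventures.HodgeRepro.Tier4.Common.ArchAssemble
import Summits.Ventures.HodgeRepro.Tier4.Common.HaarPiTransport
import Summits.Ventures.HodgeRepro.Tier4.Line1.LocallyCompactGA
import Summits.Ventures.HodgeRepro.Tier4.Line1.SecondCountableGA
import Summits.Ventures.HodgeRepro.Tier4.Line4.ArchDistBounds
import Summits.Ventures.HodgeRepro.Tier4.Line4.GASplit
import Summits.Ventures.HodgeRepro.Tier4.Line4.ArchBallReduce

/-!
# Tier4/Line4/ArchBallProduct — C-L4-ARCHBALL-PRODUCT: `G_∞ ≃ ∏_w G_w` as topological groups, and the archimedean ball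
growth `ArchBallGrowth` from a ball bound on the ONE slice `G_{w₀}` when every other slice is compact

Blind re-derivation cell `pub-hodge-repro`, Tier 4 «prove the step» (README §9–§10), seat t4-L1-p2 (prover, LINE L1, gen 5;
L4 service cut C-L4-ARCHBALL-PRODUCT, plan-4 g5 S15470, statement of record = t4-L4-p2 g4's S15527, taken S15540).  Tree
path `lean/Summits/Ventures/HodgeRepro/Tier4/Line4/ArchBallProduct.lean`.  One `def` (the slice display); no literature.

THE STATEMENT.  `ArchBallGrowth W μ∞` (ArchBallReduce, the narrowed print of (8)/(S-COUNT): `μ∞ {a ∈ G_∞ | archDist a ≤ T}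
≤ C e^{αT}`, `α < 3`) follows from the SAME bound on the ONE slice `G_{w₀} = atPlace W w₀` (the elements of `G(𝔸)` supported at
the infinite place `w₀`: finite components `1`, other infinite components `1` — MixedPlaneKType) — `SliceBallGrowth W w₀
ν_{w₀}` — once every other slice `atPlace W w`, `w ≠ w₀`, is compact (`hcpt`; the definite places) and `μ∞` is transported
to the product Haar `⊗_w ν_w` along the splitting `archSplit : G_∞ ≃ₜ* ∏_w G_w` (`archBallGrowth_of_slice`).

THE PROOF.  (i) `archSplit` is typer-2's `G_∞ = ∏_w G_w` (ArchAssemble: `ofPlace` / `assemble`, `assemble_ofPlace`,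
`ofPlace_assemble`, `ofPlace_mul`, continuity) packaged as a continuous group isomorphism, the inverse being `assemble`.
(ii) each slice is a CLOSED subgroup (`isClosed_atPlace`: `G_∞` is closed — `isClosed_infinitePart` — and «the `w′`-component
is `1`» is an entrywise closed condition through `infiniteComponent_eq_one_iff`), hence locally compact and second countable
(L1-p5's `locallyCompact_GA` / `secondCountable_GA`); (iii) Haar uniqueness along `archSplit` (L2-p1's `HaarPiTransport`:
`exists_smul_map_symm_pi_eq`) gives `μ∞ = c • (archSplit⁻¹)_*(⊗_w ν_w)`, `c > 0`; (iv) for EVERY set the push-forward along the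
measurable equivalence is the measure of the preimage (`MeasurableEquiv.map_apply`, no measurability needed), and the preimage
of the ball `{archDist ≤ T}` lies in the product set `{h ∈ G_{w₀} | archDist h ≤ T + archDist 1} × ∏_{w ≠ w₀} G_w`: `archSizeAt w`
depends only on the `w`-component (`archSizeAt_eq_of_infiniteComponent_eq`), so `archDist (assemble κ) = ∑_w log⁺ archSizeAt w
(κ w)` (`archDist_assemble`) dominates its `w₀`-term, while on the slice `archDist h = log⁺ archSizeAt w₀ h + ∑_{w ≠ w₀} log⁺
archSizeAt w 1 ≤ log⁺ archSizeAt w₀ h + archDist 1` (`archDist_le_of_mem_atPlace`); `Measure.pi_pi` evaluates the product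
set, the compact factors have finite Haar measure, and the constant becomes `c · C · e^{α · archDist 1} · ∏_{w ≠ w₀} ν_w(G_w)`
with the SAME rate `α`.  `sliceBallGrowth_of_logSublevel` converts typer-2's stage-B shape (the `log⁺ archSizeAt w₀` sublevel
sets, `0 ≤ T`) into `SliceBallGrowth` (`log⁺ archSizeAt w₀ ≤ archDist`; for `T < 0` the ball is empty).

Junk: `ν_{w₀} = 0` satisfies `SliceBallGrowth` and then `ArchBallGrowth` holds for `μ∞ = c • 0`; a Haar `ν_{w₀}` is never `0`,
and nothing here is about the objects of (P) beyond the archimedean measure of an `archDist`-ball.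

Nothing here says anything about the status of the Hodge conjecture for CM abelian varieties, which is NOT proved
(HC_CM is NOT proved by anyone in this repository).
-/

set_option autoImplicit false

noncomputable section

namespace Summit.Ventures.HodgeRepro.Tier4.Line4

open Summit.Ventures.HodgeRepro.Tier4 Summit.Ventures.HodgeRepro.Tier4.Common Summit.Ventures.HodgeRepro.Tier4.Line1
  Summit.Ventures.HodgeRepro.Tier4.Line4.L1Class MeasureTheory NumberField Topology

open scoped ENNReal NNReal

/-! ## Part A — the slices `G_w = atPlace W w` are closed subgroups; `G_∞ ≃ₜ* ∏_w G_w` -/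

section Slices

variable {k : Type} [Field k] [NumberField k] (W : PlaneData k)

/-- `G_∞` is exactly the set of elements whose finite components are all `1`. -/
theorem mem_infinitePart_iff_finiteComponent (g : GA W) :
    g ∈ infinitePart W ↔ ∀ v : IsDedekindDomain.HeightOneSpectrum (NumberField.RingOfIntegers k),
      GA.finiteComponent W v g = 1 := by
  refine ⟨fun hg v => finiteComponent_eq_one_of_mem_infinitePart W hg v, fun hg => ?_⟩
  have h : g = assemble W (fun w => ofPlace W w g) := by
    apply GA.ext_of_components
    · intro w
      rw [infiniteComponent_assemble, infiniteComponent_ofPlace_self]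
    · intro v
      rw [finiteComponent_assemble, hg v]
  rw [h]
  exact assemble_mem_infinitePart W _

/-- The slice `G_w` as a set: `G_∞` cut by the entrywise conditions «the `w′`-component is `1`», `w′ ≠ w`. -/
theorem coe_atPlace_eq (w : InfinitePlace k) :
    (atPlace W w : Set (GA W)) = (infinitePart W : Set (GA W)) ∩
      ⋂ (w' : InfinitePlace k) (_ : w' ≠ w) (i : Fin 4) (j : Fin 4),
        {g : GA W | adComponentInf k w' (GA.mat W g i j) = (1 : Matrix (Fin 4) (Fin 4) w'.Completion) i j} := by
  ext g
  simp only [SetLike.mem_coe, Set.mem_inter_iff, Set.mem_iInter, Set.mem_setOf_eq]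
  rw [mem_infinitePart_iff_finiteComponent]
  change IsAtPlace W w g ↔ _
  constructor
  · rintro ⟨h1, h2⟩
    exact ⟨h1, fun w' hw' i j => (infiniteComponent_eq_one_iff W w' g).1 (h2 w' hw') i j⟩
  · rintro ⟨h1, h2⟩
    exact ⟨h1, fun w' hw' => (infiniteComponent_eq_one_iff W w' g).2 (h2 w' hw')⟩

/-- **Each slice `G_w` is closed in `G(𝔸)`.** -/
theorem isClosed_atPlace (w : InfinitePlace k) : IsClosed (atPlace W w : Set (GA W)) := by
  rw [coe_atPlace_eq]
  refine (isClosed_infinitePart W).inter ?_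
  refine isClosed_iInter fun w' => isClosed_iInter fun _ => isClosed_iInter fun i => isClosed_iInter fun j => ?_
  exact isClosed_eq ((Common.continuous_adComponentInf w').comp (Common.continuous_mat_entry W i j)) continuous_const

/-- `G_w` is locally compact (closed in the locally compact `G(𝔸)`). -/
theorem locallyCompact_atPlace (w : InfinitePlace k) : LocallyCompactSpace (atPlace W w) := by
  haveI := locallyCompact_GA W
  exact (isClosed_atPlace W w).locallyCompactSpace

/-- `G_w` is second countable (a subspace of the second countable `G(𝔸)`). -/
theorem secondCountable_atPlace (w : InfinitePlace k) : SecondCountableTopology (atPlace W w) := by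
  haveI := secondCountable_GA W
  exact Topology.IsEmbedding.subtypeVal.secondCountableTopology

/-- **THE SPLITTING `G_∞ ≃ ∏_w G_w`** as topological groups: `a ↦ (w ↦ ofPlace w a)`, inverse `κ ↦ assemble κ`
(ArchAssemble's `assemble_ofPlace` / `ofPlace_assemble`). -/
def archSplit : infinitePart W ≃ₜ* ∀ w : InfinitePlace k, atPlace W w where
  toFun a := fun w => ⟨ofPlace W w (a : GA W), ofPlace_mem_atPlace W w (a : GA W)⟩
  invFun κ := ⟨assemble W (fun w => (κ w : GA W)), assemble_mem_infinitePart W _⟩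
  left_inv a := by
    apply Subtype.ext
    exact assemble_ofPlace W a.2
  right_inv κ := by
    funext w
    apply Subtype.ext
    exact ofPlace_assemble W (fun w => (κ w).2) w
  map_mul' a b := by
    funext w
    apply Subtype.ext
    exact ofPlace_mul W w (a : GA W) (b : GA W)
  continuous_toFun :=
    continuous_pi fun w => ((continuous_ofPlace W w).comp continuous_subtype_val).subtype_mk _
  continuous_invFun :=
    ((continuous_assemble W).comp (continuous_pi fun w => continuous_subtype_val.comp (continuous_apply w))).subtype_mk _

/-- The `w`-coordinate of `archSplit a` is the slice `ofPlace w a`. -/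
theorem coe_archSplit_apply (a : infinitePart W) (w : InfinitePlace k) :
    ((archSplit W a w : atPlace W w) : GA W) = ofPlace W w (a : GA W) := rfl

/-- The inverse of the splitting is `assemble`. -/
theorem coe_archSplit_symm_apply (κ : ∀ w : InfinitePlace k, atPlace W w) :
    (((archSplit W).symm κ : infinitePart W) : GA W) = assemble W (fun w => (κ w : GA W)) := rfl

end Slices

/-! ## Part B — `archDist` on assemblies and on a slice -/

section Dist

variable {k : Type} [Field k] [NumberField k] (W : PlaneData k)

/-- `archSizeAt w` depends only on the `w`-component. -/
theorem archSizeAt_eq_of_infiniteComponent_eq {w : InfinitePlace k} {g h : GA W}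
    (hgh : GA.infiniteComponent W w g = GA.infiniteComponent W w h) : archSizeAt W w g = archSizeAt W w h := by
  unfold archSizeAt
  refine Finset.sum_congr rfl fun i _ => Finset.sum_congr rfl fun j _ => ?_
  have hentry : adComponentInf k w (GA.mat W g i j) = adComponentInf k w (GA.mat W h i j) := by
    rw [← infiniteComponent_apply, ← infiniteComponent_apply, hgh]
  show ‖InfinitePlace.Completion.extensionEmbedding w (adComponentInf k w (GA.mat W g i j))‖ =
    ‖InfinitePlace.Completion.extensionEmbedding w (adComponentInf k w (GA.mat W h i j))‖
  rw [hentry]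

/-- The size at `w` of an assembly is the size at `w` of its `w`-member. -/
theorem archSizeAt_assemble (κ : InfinitePlace k → GA W) (w : InfinitePlace k) :
    archSizeAt W w (assemble W κ) = archSizeAt W w (κ w) :=
  archSizeAt_eq_of_infiniteComponent_eq W (infiniteComponent_assemble W κ w)

/-- Away from its place, an element of the slice `G_w` has the size of `1`. -/
theorem archSizeAt_eq_one_of_mem_atPlace {w w' : InfinitePlace k} (hw : w' ≠ w) {g : GA W}
    (hg : g ∈ atPlace W w) : archSizeAt W w' g = archSizeAt W w' 1 :=
  archSizeAt_eq_of_infiniteComponent_eq W (by rw [hg.2 w' hw, map_one])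

/-- `archDist (assemble κ) = ∑_w log⁺ archSizeAt w (κ w)`. -/
theorem archDist_assemble (κ : InfinitePlace k → GA W) :
    archDist W (assemble W κ) = ∑ w : InfinitePlace k, Real.log (max 1 (archSizeAt W w (κ w))) := by
  unfold archDist
  exact Finset.sum_congr rfl fun w _ => by rw [archSizeAt_assemble]

/-- `log⁺ archSizeAt w x ≤ archDist x` (one non-negative summand of the sum over the places). -/
theorem log_max_one_archSizeAt_le_archDist (w : InfinitePlace k) (x : GA W) :
    Real.log (max 1 (archSizeAt W w x)) ≤ archDist W x := by
  unfold archDist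
  exact Finset.single_le_sum (f := fun w' : InfinitePlace k => Real.log (max 1 (archSizeAt W w' x)))
    (fun _ _ => Real.log_nonneg (le_max_left _ _)) (Finset.mem_univ w)

/-- **On the slice `G_{w₀}`, `archDist h ≤ log⁺ archSizeAt w₀ h + archDist 1`** (the other places see the component `1`). -/
theorem archDist_le_of_mem_atPlace (w₀ : InfinitePlace k) {h : GA W} (hh : h ∈ atPlace W w₀) :
    archDist W h ≤ Real.log (max 1 (archSizeAt W w₀ h)) + archDist W 1 := by
  classical
  unfold archDist
  have h1 : ∑ w ∈ Finset.univ.erase w₀, Real.log (max 1 (archSizeAt W w h)) =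
      ∑ w ∈ Finset.univ.erase w₀, Real.log (max 1 (archSizeAt W w 1)) :=
    Finset.sum_congr rfl fun w hw => by rw [archSizeAt_eq_one_of_mem_atPlace W (Finset.ne_of_mem_erase hw) hh]
  have h2 : ∑ w ∈ Finset.univ.erase w₀, Real.log (max 1 (archSizeAt W w 1)) ≤
      ∑ w : InfinitePlace k, Real.log (max 1 (archSizeAt W w 1)) :=
    Finset.sum_le_sum_of_subset_of_nonneg (Finset.subset_univ _) fun w _ _ => Real.log_nonneg (le_max_left _ _)
  rw [← Finset.add_sum_erase Finset.univ (fun w => Real.log (max 1 (archSizeAt W w h))) (Finset.mem_univ w₀), h1]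
  linarith

/-- **The ball of `G_∞` lies in a product set**: under `archSplit⁻¹ = assemble`, `archDist ≤ T` forces the `w₀`-member into
`{archDist ≤ T + archDist 1}` and says nothing about the other members. -/
theorem preimage_archSplit_symm_sublevel_subset (w₀ : InfinitePlace k) (T : ℝ) :
    (archSplit W).symm ⁻¹' {a : infinitePart W | archDist W (a : GA W) ≤ T} ⊆
      Set.pi Set.univ (fun w => {h : atPlace W w | w = w₀ → archDist W (h : GA W) ≤ T + archDist W 1}) := by
  intro κ hκ w _ hw
  subst hw
  have hκ' : archDist W (assemble W (fun w => (κ w : GA W))) ≤ T := hκ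
  have h1 : Real.log (max 1 (archSizeAt W w (κ w))) ≤ archDist W (assemble W (fun w => (κ w : GA W))) := by
    rw [archDist_assemble]
    exact Finset.single_le_sum (f := fun w' : InfinitePlace k => Real.log (max 1 (archSizeAt W w' (κ w'))))
      (fun _ _ => Real.log_nonneg (le_max_left _ _)) (Finset.mem_univ w)
  have h2 := archDist_le_of_mem_atPlace W w (κ w).2
  linarith

end Dist

/-! ## Part C — the slice display and THE PRODUCT THEOREM -/

section Product

variable {k : Type} [Field k] [NumberField k] (W : PlaneData k) [MeasurableSpace (GA W)] [BorelSpace (GA W)]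

/-- **The slice ball growth at `w₀`** (t4-L4-p2 g4's statement of record, S15527): the `archDist`-balls of the slice
`G_{w₀}` have `ν`-measure at most `C e^{αT}` with `α < 3`. -/
def SliceBallGrowth (w₀ : InfinitePlace k) (ν : Measure (atPlace W w₀)) : Prop :=
  ∃ C α : ℝ, 0 ≤ C ∧ α < 3 ∧ ∀ T : ℝ,
    ν {h : atPlace W w₀ | archDist W (h : GA W) ≤ T} ≤ ENNReal.ofReal (C * Real.exp (α * T))

/-- **Haar uniqueness along `archSplit`**: a Haar measure on `G_∞` is a positive multiple of the transported product of
Haar measures of the slices (`HaarPiTransport.exists_smul_map_symm_pi_eq`). -/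
theorem exists_smul_map_archSplit_symm_pi_eq (μinf : Measure (infinitePart W)) [μinf.IsHaarMeasure]
    (ν : ∀ w : InfinitePlace k, Measure (atPlace W w)) [∀ w, (ν w).IsHaarMeasure] :
    ∃ c : ℝ≥0, 0 < c ∧ μinf = c • Measure.map (archSplit W).symm (Measure.pi ν) := by
  haveI := locallyCompact_infinitePart W
  haveI := secondCountable_infinitePart W
  haveI : ∀ w, LocallyCompactSpace (atPlace W w) := fun w => locallyCompact_atPlace W w
  haveI : ∀ w, SecondCountableTopology (atPlace W w) := fun w => secondCountable_atPlace W w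
  exact exists_smul_map_symm_pi_eq (archSplit W) μinf ν

/-- **THE PRODUCT THEOREM** (C-L4-ARCHBALL-PRODUCT): the slice ball growth at `w₀`, with every other slice compact, gives
`ArchBallGrowth W μ∞` for every Haar `μ∞` on `G_∞`; the constant is `c · C · e^{α · archDist 1} · ∏_{w ≠ w₀} ν_w(G_w)`, the rate
`α` is unchanged. -/
theorem archBallGrowth_of_slice (w₀ : InfinitePlace k)
    (hcpt : ∀ w : InfinitePlace k, w ≠ w₀ → IsCompact (atPlace W w : Set (GA W)))
    (μinf : Measure (infinitePart W)) [μinf.IsHaarMeasure]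
    (ν : ∀ w : InfinitePlace k, Measure (atPlace W w)) [∀ w, (ν w).IsHaarMeasure]
    (hslice : SliceBallGrowth W w₀ (ν w₀)) : ArchBallGrowth W μinf := by
  classical
  haveI := locallyCompact_infinitePart W
  haveI := secondCountable_infinitePart W
  haveI : ∀ w, LocallyCompactSpace (atPlace W w) := fun w => locallyCompact_atPlace W w
  haveI : ∀ w, SecondCountableTopology (atPlace W w) := fun w => secondCountable_atPlace W w
  haveI : ∀ w, IsLocallyFiniteMeasure (ν w) := fun w => isLocallyFiniteMeasure_of_isFiniteMeasureOnCompacts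
  haveI : ∀ w, SigmaFinite (ν w) := fun w => sigmaFinite_of_locallyFinite
  haveI : BorelSpace (∀ w : InfinitePlace k, atPlace W w) := Pi.borelSpace
  obtain ⟨c, -, hc⟩ := exists_smul_map_archSplit_symm_pi_eq W μinf ν
  obtain ⟨C, α, hC, hα, hT⟩ := hslice
  -- the finite factor: the compact slices have finite Haar measure
  set P : ℝ≥0∞ := ∏ w ∈ Finset.univ.erase w₀, ν w Set.univ with hPdef
  have hP : P ≠ ∞ := by
    refine ENNReal.prod_ne_top fun w hw => ?_
    haveI : CompactSpace (atPlace W w) := isCompact_iff_compactSpace.1 (hcpt w (Finset.ne_of_mem_erase hw))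
    exact isCompact_univ.measure_lt_top.ne
  refine ⟨(c : ℝ) * C * Real.exp (α * archDist W 1) * P.toReal, α, ?_, hα, fun T => ?_⟩
  · exact mul_nonneg (mul_nonneg (mul_nonneg c.coe_nonneg hC) (Real.exp_pos _).le) ENNReal.toReal_nonneg
  -- the transported measure of ANY set is `c` times the product measure of its preimage
  have hmeq : Measure.map (archSplit W).symm (Measure.pi ν) =
      Measure.map ((archSplit W).symm.toHomeomorph.toMeasurableEquiv) (Measure.pi ν) := rfl
  have hsm : μinf {a : infinitePart W | archDist W (a : GA W) ≤ T} =
      (c : ℝ≥0∞) * Measure.pi ν ((archSplit W).symm ⁻¹' {a : infinitePart W | archDist W (a : GA W) ≤ T}) := by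
    rw [hc, Measure.smul_apply, hmeq, MeasurableEquiv.map_apply, ENNReal.smul_def]
    rfl
  rw [hsm]
  -- the product set and its measure
  set s : ∀ w : InfinitePlace k, Set (atPlace W w) :=
    fun w => {h : atPlace W w | w = w₀ → archDist W (h : GA W) ≤ T + archDist W 1} with hsdef
  have hs₀ : s w₀ = {h : atPlace W w₀ | archDist W (h : GA W) ≤ T + archDist W 1} :=
    Set.ext fun h => ⟨fun hh => hh rfl, fun hh _ => hh⟩
  have hsw : ∀ w ∈ Finset.univ.erase w₀, s w = Set.univ := fun w hw =>
    Set.eq_univ_of_forall fun h hw' => absurd hw' (Finset.ne_of_mem_erase hw)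
  have hpi : Measure.pi ν (Set.pi Set.univ s) =
      ν w₀ {h : atPlace W w₀ | archDist W (h : GA W) ≤ T + archDist W 1} * P := by
    rw [Measure.pi_pi, ← Finset.mul_prod_erase Finset.univ (fun w => ν w (s w)) (Finset.mem_univ w₀), hs₀, hPdef]
    congr 1
    exact Finset.prod_congr rfl fun w hw => by rw [hsw w hw]
  have hx : 0 ≤ C * Real.exp (α * (T + archDist W 1)) := mul_nonneg hC (Real.exp_pos _).le
  have key : (c : ℝ≥0∞) * (ENNReal.ofReal (C * Real.exp (α * (T + archDist W 1))) * P) =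
      ENNReal.ofReal ((c : ℝ) * C * Real.exp (α * archDist W 1) * P.toReal * Real.exp (α * T)) := by
    have e1 : (c : ℝ) * C * Real.exp (α * archDist W 1) * P.toReal * Real.exp (α * T) =
        ((c : ℝ) * (C * Real.exp (α * (T + archDist W 1)))) * P.toReal := by
      rw [mul_add, Real.exp_add]
      ring
    rw [e1, ENNReal.ofReal_mul (mul_nonneg c.coe_nonneg hx), ENNReal.ofReal_mul c.coe_nonneg,
      ENNReal.ofReal_toReal hP, ENNReal.ofReal_coe_nnreal, mul_assoc]
  calc (c : ℝ≥0∞) * Measure.pi ν ((archSplit W).symm ⁻¹' {a : infinitePart W | archDist W (a : GA W) ≤ T})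
      ≤ (c : ℝ≥0∞) * Measure.pi ν (Set.pi Set.univ s) := by
        gcongr
        exact preimage_archSplit_symm_sublevel_subset W w₀ T
    _ = (c : ℝ≥0∞) * (ν w₀ {h : atPlace W w₀ | archDist W (h : GA W) ≤ T + archDist W 1} * P) := by rw [hpi]
    _ ≤ (c : ℝ≥0∞) * (ENNReal.ofReal (C * Real.exp (α * (T + archDist W 1))) * P) := by
        gcongr
        exact hT _
    _ = ENNReal.ofReal ((c : ℝ) * C * Real.exp (α * archDist W 1) * P.toReal * Real.exp (α * T)) := key

end Product

/-! ## Part D — the slice display from the `log⁺ archSizeAt w₀` sublevel bound (typer-2's stage-B shape, S15525) -/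

section Bridge

variable {k : Type} [Field k] [NumberField k] (W : PlaneData k) [MeasurableSpace (GA W)] [BorelSpace (GA W)]

omit [BorelSpace (GA W)] in
/-- **`SliceBallGrowth` from a sublevel bound on `log⁺ archSizeAt w₀` for `T ≥ 0`** (the shape of
`haar_logSublevel_le_exp_of_hom` at `N := archSizeAt w₀`, `α := 2 + ε`): `log⁺ archSizeAt w₀ h ≤ archDist h`, so the
`archDist`-ball lies in the `log⁺`-sublevel set; for `T < 0` the `archDist`-ball is empty. -/
theorem sliceBallGrowth_of_logSublevel (w₀ : InfinitePlace k) (ν : Measure (atPlace W w₀)) {α : ℝ} (hα : α < 3)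
    (h : ∃ C : ℝ, 0 ≤ C ∧ ∀ T : ℝ, 0 ≤ T →
      ν {h : atPlace W w₀ | Real.log (max 1 (archSizeAt W w₀ (h : GA W))) ≤ T} ≤
        ENNReal.ofReal (C * Real.exp (α * T))) :
    SliceBallGrowth W w₀ ν := by
  obtain ⟨C, hC, hT⟩ := h
  refine ⟨C, α, hC, hα, fun T => ?_⟩
  by_cases hT0 : 0 ≤ T
  · calc ν {h : atPlace W w₀ | archDist W (h : GA W) ≤ T}
        ≤ ν {h : atPlace W w₀ | Real.log (max 1 (archSizeAt W w₀ (h : GA W))) ≤ T} :=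
          measure_mono fun h hh => le_trans (log_max_one_archSizeAt_le_archDist W w₀ (h : GA W)) hh
      _ ≤ ENNReal.ofReal (C * Real.exp (α * T)) := hT T hT0
  · have hempty : {h : atPlace W w₀ | archDist W (h : GA W) ≤ T} = ∅ :=
      Set.eq_empty_of_forall_notMem fun h hh => hT0 (le_trans (archDist_nonneg W _) hh)
    rw [hempty, measure_empty]
    exact zero_le

end Bridge

end Summit.Ventures.HodgeRepro.Tier4.Line4

end
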